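import Summits.Ventures.PercRepro.RankLevelSetLevelSixT20Cell7
import Summits.Ventures.PercRepro.RankLevelSetLevelSixT20Cell8
import Summits.Ventures.PercRepro.RankLevelSetLevelSixT20Cell9
import Summits.Ventures.PercRepro.RankLevelSetLevelSixT20Cell10
import Summits.Ventures.PercRepro.RankLevelSetLevelSixT20Cell11
import Summits.Ventures.PercRepro.RankLevelSetLevelSixT20Cell12
import Summits.Ventures.PercRepro.RankLevelSetLevelSixT20Cell13
import Summits.Ventures.PercRepro.RankLevelSetLevelSixT20Cell14
import Summits.Ventures.PercRepro.RankLevelSetLevelSixT20Cell15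
import Summits.Ventures.PercRepro.RankLevelSetLevelSixT20Cell16
import Summits.Ventures.PercRepro.RankLevelSetLevelSixT20Cell17
import Summits.Ventures.PercRepro.RankLevelSetLevelSixT20Cell18
import Summits.Ventures.PercRepro.RankLevelSetLevelSixT20Cell19
import Summits.Ventures.PercRepro.RankLevelSetLevelSixT20Cell20
import Summits.Ventures.PercRepro.RankLevelSetLevelSixT20Cell21
import Summits.Ventures.PercRepro.RankLevelSetLevelSixT20Cell22
import Summits.Ventures.PercRepro.RankLevelSetLevelSixT20BasisMid1
import Summits.Ventures.PercRepro.RankLevelSetLevelSixT20BasisMid2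
import Summits.Ventures.PercRepro.RankLevelSetLevelSixT20BasisMid3
import Summits.Ventures.PercRepro.RankLevelSetLevelSixT20RegII
import Summits.Ventures.PercRepro.RankLevelSetLevelSixT21Assembly
import Summits.Ventures.PercRepro.RankLevelSetLevelFiveCqFifteen

/-!
# PercRepro — THE 20 ROW: `c025_six_large_twenty (20 ≤ p) : RLS M p 6` — C-025 AT LEVEL `6` FOR EVERY `p ≥ 20`, EVERY FINITE MATROID (p8 g15, S3)

The core cells `(20, d)`: `d ∈ [7, 8, 9, 10, 11, 12, 13, 14, 15, 16, 17, 18, 19, 20, 21, 22]` by THE COLOOP DEVICE WITH THE LP CHAIN (`c025_core_six_twenty_d`: `k = 0` and the chain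
steps the coloop-free cells of p2's nullity-split coloop/closure LP run at level `6` (`S3LP.s6lp_*`, natural or scaled), then the
exported-count rows and the trivial rows), `22 … 30, 31 … 39, 40 … 43` by the basis cells
(`c025_core_six_t20_basis_mid1, c025_core_six_t20_basis_mid2, c025_core_six_t20_basis_mid3`), `d ≥ 44` by regime II (`c025_core_six_regII_basis_20`). Then the level-5 glue:
`rls_six_at_of_core 20` on p7's `c025_five_large_sharp15` (level `5` at `p = 19`) and the 21 row (`c025_six_large_twenty_one`) for `p ≥ 21`.
Axioms: standard.
-/

open scoped Matroid

namespace PercRepro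

namespace ThmN

variable {α : Type}

/-- **The core cell `(20, d)` at every corank `d ≥ 23`, every `e`-free core** (the basis cells and regime II). -/
theorem c025_core_six_twenty_large (M : Matroid α) [M.Finite] (d : ℕ) (hd : 23 ≤ d)
    (hR : M.eRank = (20 : ℕ∞)) (hn : M.E.ncard = 20 + d)
    (hfree : ∀ e ∈ M.E, ∃ A ⊆ M.E \ {e}, e ∉ M.closure A ∧ e ∉ M.closure ((M.E \ {e}) \ A)) :
    RLS M 20 6 := by
  rcases Nat.lt_or_ge d 31 with h30 | h30'
  · exact c025_core_six_t20_basis_mid1 M d (by omega) (by omega) hR hn hfree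
  rcases Nat.lt_or_ge d 40 with h39 | h39'
  · exact c025_core_six_t20_basis_mid2 M d (by omega) (by omega) hR hn hfree
  rcases Nat.lt_or_ge d 44 with h43 | h43'
  · exact c025_core_six_t20_basis_mid3 M d (by omega) (by omega) hR hn hfree
  exact c025_core_six_regII_basis_20 M d (by omega) hR hn hfree

/-- **The core cell `(20, d)` at every corank `d ≥ 7`, every `e`-free core.** -/
theorem c025_core_six_twenty (M : Matroid α) [M.Finite] (d : ℕ) (hd7 : 7 ≤ d)
    (hR : M.eRank = (20 : ℕ∞)) (hn : M.E.ncard = 20 + d)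
    (hfree : ∀ e ∈ M.E, ∃ A ⊆ M.E \ {e}, e ∉ M.closure A ∧ e ∉ M.closure ((M.E \ {e}) \ A)) :
    RLS M 20 6 := by
  rcases Nat.lt_or_ge d 23 with hlt | hge
  · interval_cases d
    · exact c025_core_six_twenty_7 M hR hn hfree
    · exact c025_core_six_twenty_8 M hR hn hfree
    · exact c025_core_six_twenty_9 M hR hn hfree
    · exact c025_core_six_twenty_10 M hR hn hfree
    · exact c025_core_six_twenty_11 M hR hn hfree
    · exact c025_core_six_twenty_12 M hR hn hfree
    · exact c025_core_six_twenty_13 M hR hn hfree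
    · exact c025_core_six_twenty_14 M hR hn hfree
    · exact c025_core_six_twenty_15 M hR hn hfree
    · exact c025_core_six_twenty_16 M hR hn hfree
    · exact c025_core_six_twenty_17 M hR hn hfree
    · exact c025_core_six_twenty_18 M hR hn hfree
    · exact c025_core_six_twenty_19 M hR hn hfree
    · exact c025_core_six_twenty_20 M hR hn hfree
    · exact c025_core_six_twenty_21 M hR hn hfree
    · exact c025_core_six_twenty_22 M hR hn hfree
  · exact c025_core_six_twenty_large M d hge hR hn hfree

/-- **THEOREM C₆ AT RANK `20`, GIVEN LEVEL `5`**: level `5` for all `p ≥ 19` implies level `6` for all `p ≥ 20`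
(`p = 20` by the cells and `rls_six_at_of_core`; `p ≥ 21` by the 21 row). -/
theorem c025_six_of_five_t20
    (h5 : ∀ (M : Matroid α) [M.Finite] (p : ℕ), 19 ≤ p → RLS M p 5) :
    ∀ (M : Matroid α) [M.Finite] (p : ℕ), 20 ≤ p → RLS M p 6 := by
  intro M _ p hp
  rcases Nat.lt_or_ge p 21 with hlt | hge
  · have hP : p = 20 := by omega
    subst hP
    refine rls_six_at_of_core 20 (by norm_num) (fun M _ => h5 M 19 (by norm_num)) ?_ M
    intro M _ d hd hR hn hfree
    exact c025_core_six_twenty M d hd hR hn hfree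
  · exact c025_six_large_twenty_one M p hge

/-- **C-025 AT LEVEL `6` FOR EVERY `p ≥ 20`, EVERY FINITE MATROID** — on p7's `c025_five_large_sharp15 (15 ≤ p)`. -/
theorem c025_six_large_twenty (M : Matroid α) [M.Finite] (p : ℕ) (hp : 20 ≤ p) : RLS M p 6 :=
  c025_six_of_five_t20 (fun M _ p hp => c025_five_large_sharp15 M p (by omega)) M p hp

end ThmN

end PercRepro
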